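import Literature.AnabelianGeometry.EtaleTheta.ThetaSubquotientChangeOfCoefficients
import Literature.AnabelianGeometry.EtaleTheta.Discharge.Sec5ThetaSubquotientOfDoubleUnderline
import Literature.AnabelianGeometry.EtaleTheta.ThetaSubquotientLevelN
import Literature.AnabelianGeometry.EtaleTheta.RigidOfSetting

/-!
# [EtTh] §5 at the Setting: the comparison `(l·Δ_Θ)_E → (l·Δ_Θ ⊗ ℤ/Nℤ)_E` from print's theta subquotients to the
# level-`N` ones ("thetaMod-vs-evalEquiv")

Mochizuki, *The étale theta function and its Frobenioid-theoretic manifestations*, Publ. RIMS **45** (2009), §5 p. 327 (PDF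
p. 101): "`(Π^tp_X)^Θ ⊇ l·Δ_Θ` … `(l·Δ_Θ)_D ⊆ Aut^Θ_D(D)`"; Def. 5.4 (b) / Prop. 5.5 ("`(l·Δ_Θ)_S ⊗ ℤ/Nℤ`"); Prop. 2.12 (i) p. 271 (PDF
p. 45) ("`l·Δ_Θ ↠ (l·Δ_Θ) ⊗ ℤ/Nℤ ≅ μ_N`").  [cite: MochizukiEtTh2009, §5 p.327 (PDF p.101)]
abc-iut cell, layer L2, seat abc-iut-L2-t9 (gen 3; unit W2-L2-05 lineage), row «CHANGE OF COEFFICIENTS for the theta subquotients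
(thetaMod-vs-evalEquiv)», the INSTANCE announced with `ThetaSubquotientChangeOfCoefficients.lean` (p437002).  CONSTRUCTION file
(DEFS-FREEZE class (b)): two `def`s (canonical homomorphisms), no instance/notation/`Prop`-def; nothing landed is edited or restated.

THE TWO PAIRS at the double underline base `B^temp(Π^tp_X̲̲)⁰` of the §5 data of the Setting (`C : E.DoubleUnderline l`,
abc-iut-L2-t8's `RD := C.rigidData μ hC hS h15 L`, `ιX := id`):
* print's `(q, ι) = ((Π^tp_X ↠ (Π^tp_X)^Θ)|_{Π^tp_X̲̲}, l·Δ_Θ ↪ (Π^tp_X)^Θ)` — abc-iut-L2-t9's PIN `ThetaSubquotient.ofSettingSub D l C.Huu`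
  (`ThetaSubquotientOfThetaSetting.lean`, p434716; abc-iut-L2-t4's `ofThetaSettingDataQ`);
* the LEVEL-`N` pair `(q_N, ι_N) = (Π^tp_X̲̲ ↠ Π^tp_X̲̲/K_N, μ_N ↪ Π^tp_X̲̲/K_N)` — abc-iut-w4-d042's `RD.levelStub (refl)`
  (`ThetaSubquotientLevelN.lean`, p430659; `Sec5Prop55OfConnectedTemperoidLevelN`).
The second is the first with coefficients reduced along `thetaMod = μ.red : l·Δ_Θ ↠ μ_N` — but only after CORESTRICTING `q` to its
image `(Π^tp_X̲̲)^Θ = q(Π^tp_X̲̲) ⊊ (Π^tp_X)^Θ` (which contains `l·Δ_Θ`, abc-iut-L2-t9's `range_ιTheta_le_range_qSub_Huu`, p436169), on which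
`q_N` descends (`Ker q = thetaKer ≤ K_N`).

WHAT IS CONSTRUCTED / PROVED.
* `thetaKer_le_levelKer` — `Ker(Π^tp_X̲̲ → (Π^tp_X)^Θ) ≤ K_N`;
* **`levelQuotOfRange : (Π^tp_X̲̲)^Θ →* Π^tp_X̲̲/K_N`**, the descent of `q_N` (`levelQuotOfRange_apply_qSub : [q k] ↦ [k]`), with the two
  defining equations of a morphism of coefficient pairs `(q₀, ι₀) → (q_N, ι_N)`: `levelQuotOfRange_comp_qRes` (`φ₀ ∘ q₀ = q_N`) and
  **`levelQuotOfRange_comp_ιRes` (`φ₀ ∘ ι₀ = ι_N ∘ red`)** — abc-iut-L2-t8's `thetaMod := red ∘ toLDelta` and abc-iut-w4-d042's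
  `iotaN_thetaMod`;
* **`settingToLevelN E : (l·Δ_Θ)_E(q, ι) →* (l·Δ_Θ ⊗ ℤ/Nℤ)_E(q_N, ι_N)`** := `coeffMap` along `(φ₀, red)` after the corestriction
  isomorphism `coeffEquivOfCodRestrict` (p437002), for EVERY object `E` of `B^temp(Π^tp_X̲̲)`;
  `settingToLevelN_mk` — on a compatible family `t`: `[t] ↦ [red ∘ t]`;
  **`evalAt_settingToLevelN_mk`** — "thetaMod-vs-evalEquiv": evaluated at any point `x`, `[t] ↦ [red (t x)] ∈ μ_N/J_N(Stab x)`;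
  **`map_settingToLevelN`** — commutes with the transports along every morphism of connected objects (a morphism of
  `ThetaSubquotientStub` data `ofSettingSub D l C.Huu ⟶ RD.levelStub (refl)` objectwise: `ofSettingSub_lDeltaMap_settingToLevelN`);
  `autPre_setting_le_levelN` — print's `Aut`-subquotient domain for `(q, ι)` lies in the level-`N` one;
  **`settingToLevelN_autProj`** — and the `Aut`-projections correspond (`settingToLevelN (autProj σ) = autProj_N σ`) at connected objects;
  `autPre_setting_eq_levelN` (v2) — in fact the two `Aut`-subquotient DOMAINS coincide (abc-iut-w4-d042's `qN_ιX_mem_range_iff`).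
So every statement PROVED for `Q := levelStub` (abc-iut-w4-d042's Prop. 5.5 binders) is reached from `Q := ofSettingSub` through ONE
canonical, transport-compatible, `Aut`-compatible homomorphism.

HONEST FRAMING: constructions over abc-iut-L2-t1's / -t8's DATA structures (`ThetaSetting`, `DoubleUnderline`, `CyclotomeMod`, `rigidData`);
nothing asserts such data exist for an actual curve; [EtTh] is refereed and nothing here bears on [IUTchIII] Cor. 3.12 — no side is taken;
typed ≠ proved.
-/

noncomputable section

namespace Literature.AnabelianGeometry.EtaleTheta

open CategoryTheory Literature.AlgebraicGeometry.Frobenioids Literature.AnabelianGeometry.SemiGraphs ThetaSubquotient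
open Literature.AlgebraicGeometry.Frobenioids.QuasiTemperoid (stabilizerSubgroup)
open scoped IsMulCommutative

namespace ThetaSetting.EtaleThetaData.DoubleUnderline

variable {p : ℕ} [Fact p.Prime] {D : ThetaSetting p} {E : D.EtaleThetaData} {l : ℕ} (C : E.DoubleUnderline l)
  {N : ℕ+} (μ : D.CyclotomeMod l N) (hC : D.Compat) (hS : D.Sec2Hyps) (h15 : Prop15iii E hC) (L : C.CuspLabels)

/-! ### 1. `q_N` descends to `(Π^tp_X̲̲)^Θ = q(Π^tp_X̲̲)` -/

/-- `Ker(Π^tp_X̲̲ → (Π^tp_X)^Θ) ≤ K_N` (`thetaMod = red ∘ toLDelta` kills `thetaKer`).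
[cite: MochizukiEtTh2009, §2 p.272 (PDF p.46)] -/
theorem thetaKer_le_levelKer : (qSub D C.Huu).ker ≤ (C.rigidData μ hC hS h15 L).levelKer := by
  intro k hk
  have hk' : k ∈ (C.rigidData μ hC hS h15 L).lDeltaTheta := (C.rigidData μ hC hS h15 L).thetaKer_le_lDeltaTheta hk
  refine ((C.rigidData μ hC hS h15 L).mem_levelKer_iff k).2 ⟨⟨k, hk'⟩, ?_, rfl⟩
  have h1 : C.toLDelta ⟨k, hk'⟩ = 1 := Subtype.ext (by
    rw [coe_toLDelta]; exact (MonoidHom.mem_ker.1 hk))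
  change μ.red (C.toLDelta ⟨k, hk'⟩) = 1
  rw [h1, map_one]

/-- **`φ₀ : (Π^tp_X̲̲)^Θ = q(Π^tp_X̲̲) → Π^tp_X̲̲/K_N`**, the descent of `q_N` along `Π^tp_X̲̲ ↠ q(Π^tp_X̲̲)` (Noether).
[cite: MochizukiEtTh2009, §5 p.327 (PDF p.101)] -/
def levelQuotOfRange : ↥(qSub D C.Huu).range →* (C.rigidData μ hC hS h15 L).LevelQuot :=
  (QuotientGroup.map (qSub D C.Huu).ker (C.rigidData μ hC hS h15 L).levelKer (MonoidHom.id _)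
      (by simpa using C.thetaKer_le_levelKer μ hC hS h15 L)).comp
    (QuotientGroup.quotientKerEquivRange (qSub D C.Huu)).symm.toMonoidHom

/-- `φ₀ (q k) = [k]`. [cite: MochizukiEtTh2009, §5 p.327 (PDF p.101)] -/
theorem levelQuotOfRange_apply_qSub (k : C.Huu) (hk : qSub D C.Huu k ∈ (qSub D C.Huu).range) :
    C.levelQuotOfRange μ hC hS h15 L ⟨qSub D C.Huu k, hk⟩ = ((k : C.Huu) : (C.rigidData μ hC hS h15 L).LevelQuot) := by
  have h : (QuotientGroup.quotientKerEquivRange (qSub D C.Huu)).symm ⟨qSub D C.Huu k, hk⟩ = QuotientGroup.mk k := by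
    rw [MulEquiv.symm_apply_eq]; rfl
  unfold levelQuotOfRange
  rw [MonoidHom.comp_apply, MulEquiv.coe_toMonoidHom, h, QuotientGroup.map_mk, MonoidHom.id_apply]

/-- `q(Π^tp_X̲̲) ⊇ q(Π^tp_X̲̲)` (for the corestriction). [cite: MochizukiEtTh2009, §5 p.327 (PDF p.101)] -/
theorem qSub_mem_range (g : C.Huu) : qSub D C.Huu g ∈ (qSub D C.Huu).range := ⟨g, rfl⟩

/-- `ι(l·Δ_Θ) ⊆ q(Π^tp_X̲̲)` (abc-iut-L2-t9's `range_ιTheta_le_range_qSub_Huu`, p436169), for the corestriction.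
[cite: MochizukiEtTh2009, Prop 2.12 (i) p.271 (PDF p.45)] -/
theorem ιTheta_mem_range (a : D.lDeltaTheta l) : ιTheta D l a ∈ (qSub D C.Huu).range :=
  C.range_ιTheta_le_range_qSub_Huu ⟨a, rfl⟩

/-- `φ₀ ∘ q₀ = q_N` (`ιX := id`): the first equation of the morphism of coefficient pairs.
[cite: MochizukiEtTh2009, §5 p.327 (PDF p.101)] -/
theorem levelQuotOfRange_comp_qRes :
    (C.levelQuotOfRange μ hC hS h15 L).comp (qRes (qSub D C.Huu) (qSub D C.Huu).range C.qSub_mem_range) =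
      (C.rigidData μ hC hS h15 L).qN (ContinuousMulEquiv.refl _) := by
  ext k
  rw [MonoidHom.comp_apply]
  exact (C.levelQuotOfRange_apply_qSub μ hC hS h15 L k _).trans
    ((C.rigidData μ hC hS h15 L).qN_apply_ιX (ContinuousMulEquiv.refl _) k).symm

/-- **`φ₀ ∘ ι₀ = ι_N ∘ red`**: on `l·Δ_Θ`, descending `q_N` and reducing mod `N` agree — abc-iut-L2-t8's `thetaMod := red ∘ toLDelta` and
abc-iut-w4-d042's `iotaN_thetaMod`.  The second equation of the morphism of coefficient pairs. [cite: MochizukiEtTh2009, Prop 2.12 (i) p.271 (PDF p.45)] -/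
theorem levelQuotOfRange_comp_ιRes :
    (C.levelQuotOfRange μ hC hS h15 L).comp (ιRes (ιTheta D l) (qSub D C.Huu).range C.ιTheta_mem_range) =
      (C.rigidData μ hC hS h15 L).iotaN.comp μ.red := by
  ext a
  obtain ⟨k, hk⟩ := C.ιTheta_mem_range a
  have hk' : k ∈ (C.rigidData μ hC hS h15 L).lDeltaTheta := by
    change k ∈ (D.lDeltaTheta l).comap (qSub D C.Huu)
    rw [Subgroup.mem_comap, hk]; exact a.2
  have hval : (ιRes (ιTheta D l) (qSub D C.Huu).range C.ιTheta_mem_range a) = ⟨qSub D C.Huu k, ⟨k, rfl⟩⟩ :=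
    Subtype.ext hk.symm
  have hred : μ.red a = (C.rigidData μ hC hS h15 L).thetaMod ⟨k, hk'⟩ := by
    change μ.red a = μ.red (C.toLDelta ⟨k, hk'⟩)
    congr 1
    exact Subtype.ext (by rw [coe_toLDelta]; exact hk.symm)
  rw [MonoidHom.comp_apply, MonoidHom.comp_apply, hval, C.levelQuotOfRange_apply_qSub μ hC hS h15 L, hred,
    (C.rigidData μ hC hS h15 L).iotaN_thetaMod]

/-! ### 2. The comparison homomorphism -/

/-- `ι₀(l·Δ_Θ)` is normal in `q(Π^tp_X̲̲)` (instance form for the corestricted pair). [cite: MochizukiEtTh2009, §5 p.327 (PDF p.101)] -/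
theorem range_ιRes_normal_Huu : (ιRes (ιTheta D l) (qSub D C.Huu).range C.ιTheta_mem_range).range.Normal :=
  range_ιRes_normal (ιTheta D l) _ _

/-- **The comparison `(l·Δ_Θ)_E(q, ι) → (l·Δ_Θ ⊗ ℤ/Nℤ)_E(q_N, ι_N)`** for every object `E` of `B^temp(Π^tp_X̲̲)`: corestrict to
`q(Π^tp_X̲̲)` (`coeffEquivOfCodRestrict`, an isomorphism) then change coefficients along `(φ₀, red)` (`coeffMap`).
[cite: MochizukiEtTh2009, §5 p.327 (PDF p.101)] -/
def settingToLevelN (E : BTemp ↥C.Huu) :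
    LDelta (qSub D C.Huu) (ιTheta D l) E →*
      haveI := (C.rigidData μ hC hS h15 L).iotaN_range_normal
      LDelta ((C.rigidData μ hC hS h15 L).qN (ContinuousMulEquiv.refl _)) (C.rigidData μ hC hS h15 L).iotaN E :=
  haveI := (C.rigidData μ hC hS h15 L).iotaN_range_normal
  haveI := C.range_ιRes_normal_Huu (l := l)
  (coeffMap (qRes (qSub D C.Huu) (qSub D C.Huu).range C.qSub_mem_range)
        (ιRes (ιTheta D l) (qSub D C.Huu).range C.ιTheta_mem_range)
        ((C.rigidData μ hC hS h15 L).qN (ContinuousMulEquiv.refl _)) (C.rigidData μ hC hS h15 L).iotaN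
        (C.levelQuotOfRange μ hC hS h15 L) μ.red
        (C.levelQuotOfRange_comp_qRes μ hC hS h15 L) (C.levelQuotOfRange_comp_ιRes μ hC hS h15 L) E).comp
    (coeffEquivOfCodRestrict (qSub D C.Huu) (ιTheta D l) (qSub D C.Huu).range C.qSub_mem_range C.ιTheta_mem_range E).symm.toMonoidHom

/-- `red ∘ t` is a level-`N` compatible family when `t` is a `(q, ι)`-compatible family.
[cite: MochizukiEtTh2009, §5 p.327 (PDF p.101)] -/
theorem red_comp_mem_fam (E : BTemp ↥C.Huu) (t : Fam (qSub D C.Huu) (ιTheta D l) E) :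
    haveI := (C.rigidData μ hC hS h15 L).iotaN_range_normal
    (μ.red ∘ (t : E.obj.V → ↥(D.lDeltaTheta l))) ∈
      Fam ((C.rigidData μ hC hS h15 L).qN (ContinuousMulEquiv.refl _)) (C.rigidData μ hC hS h15 L).iotaN E := by
  haveI := (C.rigidData μ hC hS h15 L).iotaN_range_normal
  haveI := C.range_ιRes_normal_Huu (l := l)
  have ht : (t : E.obj.V → ↥(D.lDeltaTheta l)) ∈
      Fam (qRes (qSub D C.Huu) (qSub D C.Huu).range C.qSub_mem_range)
        (ιRes (ιTheta D l) (qSub D C.Huu).range C.ιTheta_mem_range) E := by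
    rw [fam_codRestrict_eq]; exact t.2
  exact comp_mem_fam (qRes (qSub D C.Huu) (qSub D C.Huu).range C.qSub_mem_range)
    (ιRes (ιTheta D l) (qSub D C.Huu).range C.ιTheta_mem_range)
    ((C.rigidData μ hC hS h15 L).qN (ContinuousMulEquiv.refl _)) (C.rigidData μ hC hS h15 L).iotaN
    (C.levelQuotOfRange μ hC hS h15 L) μ.red
    (C.levelQuotOfRange_comp_qRes μ hC hS h15 L) (C.levelQuotOfRange_comp_ιRes μ hC hS h15 L) E ht

/-- **`settingToLevelN [t] = [red ∘ t]`** on compatible families. [cite: MochizukiEtTh2009, §5 p.327 (PDF p.101)] -/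
theorem settingToLevelN_mk (E : BTemp ↥C.Huu) (t : Fam (qSub D C.Huu) (ιTheta D l) E) :
    C.settingToLevelN μ hC hS h15 L E (ThetaSubquotient.mk _ _ E t) =
      haveI := (C.rigidData μ hC hS h15 L).iotaN_range_normal
      ThetaSubquotient.mk _ _ E ⟨μ.red ∘ (t : E.obj.V → ↥(D.lDeltaTheta l)), C.red_comp_mem_fam μ hC hS h15 L E t⟩ := by
  haveI := (C.rigidData μ hC hS h15 L).iotaN_range_normal
  haveI := C.range_ιRes_normal_Huu (l := l)
  have ht : (t : E.obj.V → ↥(D.lDeltaTheta l)) ∈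
      Fam (qRes (qSub D C.Huu) (qSub D C.Huu).range C.qSub_mem_range)
        (ιRes (ιTheta D l) (qSub D C.Huu).range C.ιTheta_mem_range) E := by
    rw [fam_codRestrict_eq]; exact t.2
  have hsymm : (coeffEquivOfCodRestrict (qSub D C.Huu) (ιTheta D l) (qSub D C.Huu).range C.qSub_mem_range
      C.ιTheta_mem_range E).symm (ThetaSubquotient.mk _ _ E t) = ThetaSubquotient.mk _ _ E ⟨(t : E.obj.V → ↥(D.lDeltaTheta l)), ht⟩ := by
    rw [MulEquiv.symm_apply_eq]
    exact (coeffEquivOfCodRestrict_mk (qSub D C.Huu) (ιTheta D l) (qSub D C.Huu).range C.qSub_mem_range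
      C.ιTheta_mem_range E ⟨_, ht⟩).symm
  unfold settingToLevelN
  rw [MonoidHom.comp_apply, MulEquiv.coe_toMonoidHom, hsymm, coeffMap_mk]
  rfl

/-- **"thetaMod-vs-evalEquiv"**: evaluated at any point `x ∈ E`, the comparison reduces the value mod `N`:
`evalAt_N x (settingToLevelN [t]) = [red (t x)] ∈ μ_N / J_N(Stab x)`. [cite: MochizukiEtTh2009, §5 p.327 (PDF p.101)] -/
theorem evalAt_settingToLevelN_mk (E : BTemp ↥C.Huu) (t : Fam (qSub D C.Huu) (ιTheta D l) E) (x : E.obj.V) :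
    haveI := (C.rigidData μ hC hS h15 L).iotaN_range_normal
    evalAt _ _ E x (C.settingToLevelN μ hC hS h15 L E (ThetaSubquotient.mk _ _ E t)) =
      QuotientGroup.mk (μ.red ((t : E.obj.V → ↥(D.lDeltaTheta l)) x)) := by
  rw [settingToLevelN_mk]
  rfl

/-! ### 3. Compatibility with transports and with print's `Aut`-subquotient -/

/-- **The comparison commutes with the transports** along every morphism `f : E → E′` of connected objects of `B^temp(Π^tp_X̲̲)`.
[cite: MochizukiEtTh2009, §5 p.327 (PDF p.101)] -/
theorem map_settingToLevelN {E E' : BTemp ↥C.Huu} (hE : IsConnectedObj E) (hE' : IsConnectedObj E') (f : E ⟶ E')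
    (c : LDelta (qSub D C.Huu) (ιTheta D l) E) :
    haveI := (C.rigidData μ hC hS h15 L).iotaN_range_normal
    map _ _ hE hE' f (C.settingToLevelN μ hC hS h15 L E c) = C.settingToLevelN μ hC hS h15 L E' (map _ _ hE hE' f c) := by
  haveI := (C.rigidData μ hC hS h15 L).iotaN_range_normal
  induction c using QuotientGroup.induction_on with
  | H t =>
    rw [map_mk, settingToLevelN_mk, settingToLevelN_mk, map_mk]
    rfl

/-- In abc-iut-L2-t4's stub language: objectwise, `settingToLevelN` intertwines the `lDeltaMap`s of abc-iut-L2-t9's PIN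
`ofSettingSub D l C.Huu` and of abc-iut-w4-d042's `RD.levelStub (refl)`. [cite: MochizukiEtTh2009, §5 p.327 (PDF p.101)] -/
theorem ofSettingSub_lDeltaMap_settingToLevelN {E E' : ConnectedPart (BTemp ↥C.Huu)} (f : E ⟶ E') (c : (ofSettingSub D l C.Huu).lDelta E) :
    ((C.rigidData μ hC hS h15 L).levelStub (ContinuousMulEquiv.refl _)).lDeltaMap f (C.settingToLevelN μ hC hS h15 L E.obj c) =
      C.settingToLevelN μ hC hS h15 L E'.obj ((ofSettingSub D l C.Huu).lDeltaMap f c) :=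
  C.map_settingToLevelN μ hC hS h15 L E.property E'.property f.hom c

/-- Print's `Aut`-subquotient domain for `(q, ι)` is contained in the level-`N` one: `autPre(q, ι) E ≤ autPre(q_N, ι_N) E`.
[cite: MochizukiEtTh2009, §5 p.327 (PDF p.101)] -/
theorem autPre_setting_le_levelN (E : BTemp ↥C.Huu) :
    autPre (qSub D C.Huu) (ιTheta D l) E ≤
      autPre ((C.rigidData μ hC hS h15 L).qN (ContinuousMulEquiv.refl _)) (C.rigidData μ hC hS h15 L).iotaN E := by
  intro σ hσ x
  obtain ⟨n, ⟨a, ha⟩, hx⟩ := hσ x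
  refine ⟨n, ⟨μ.red a, ?_⟩, hx⟩
  have h1 := DFunLike.congr_fun (C.levelQuotOfRange_comp_ιRes μ hC hS h15 L) a
  have h2 := DFunLike.congr_fun (C.levelQuotOfRange_comp_qRes μ hC hS h15 L) n
  rw [MonoidHom.comp_apply, MonoidHom.comp_apply] at h1
  rw [MonoidHom.comp_apply] at h2
  rw [← h1, ← h2]
  congr 1
  exact Subtype.ext ha

/-- **The `Aut`-projections correspond under the comparison** at a connected object:
`settingToLevelN (autProj(q, ι) σ) = autProj(q_N, ι_N) σ`. [cite: MochizukiEtTh2009, §5 p.327 (PDF p.101)] -/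
theorem settingToLevelN_autProj (E : BTemp ↥C.Huu) (hE : IsConnectedObj E) (σ : autPre (qSub D C.Huu) (ιTheta D l) E) :
    haveI := (C.rigidData μ hC hS h15 L).iotaN_range_normal
    C.settingToLevelN μ hC hS h15 L E (autProj _ _ E σ) =
      autProj _ _ E ⟨σ, C.autPre_setting_le_levelN μ hC hS h15 L E σ.2⟩ := by
  haveI := (C.rigidData μ hC hS h15 L).iotaN_range_normal
  obtain ⟨x⟩ := QuasiTemperoid.BTempConnected.nonempty_of_isConnectedObj E hE
  apply evalAt_injective _ _ hE x
  obtain ⟨n, ⟨a, ha⟩, hx⟩ := σ.2 x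
  have ha' : (C.rigidData μ hC hS h15 L).iotaN (μ.red a) =
      (C.rigidData μ hC hS h15 L).qN (ContinuousMulEquiv.refl _) n := by
    have h1 := DFunLike.congr_fun (C.levelQuotOfRange_comp_ιRes μ hC hS h15 L) a
    have h2 := DFunLike.congr_fun (C.levelQuotOfRange_comp_qRes μ hC hS h15 L) n
    rw [MonoidHom.comp_apply, MonoidHom.comp_apply] at h1
    rw [MonoidHom.comp_apply] at h2
    rw [← h1, ← h2]
    congr 1
    exact Subtype.ext ha
  -- `autProj σ` is the class of a family whose value at `x` is congruent to `a`
  rw [evalAt_autProj _ _ E _ x n (μ.red a) ha' hx]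
  have key := evalAt_autProj (qSub D C.Huu) (ιTheta D l) E σ x n a ha hx
  -- write `autProj σ = [t]` and transport the congruence at `x` along `red`
  obtain ⟨t, ht⟩ := QuotientGroup.mk_surjective (autProj (qSub D C.Huu) (ιTheta D l) E σ)
  rw [← ht] at key ⊢
  have e1 : evalAt _ _ E x (C.settingToLevelN μ hC hS h15 L E (ThetaSubquotient.mk _ _ E t)) =
      QuotientGroup.mk (μ.red ((t : E.obj.V → ↥(D.lDeltaTheta l)) x)) :=
    C.evalAt_settingToLevelN_mk μ hC hS h15 L E t x
  have e2 : evalAt (qSub D C.Huu) (ιTheta D l) E x (ThetaSubquotient.mk _ _ E t) =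
      QuotientGroup.mk ((t : E.obj.V → ↥(D.lDeltaTheta l)) x) := evalAt_mk _ _ E x t
  change evalAt _ _ E x (C.settingToLevelN μ hC hS h15 L E (ThetaSubquotient.mk _ _ E t)) = _
  change evalAt (qSub D C.Huu) (ιTheta D l) E x (ThetaSubquotient.mk _ _ E t) = _ at key
  rw [e1, QuotientGroup.eq]
  rw [e2, QuotientGroup.eq] at key
  -- `key : (t x)⁻¹ * a ∈ ι⁻¹J(Stab x)`; push through `red` with `kill_le_comap` for the corestricted pair
  haveI := C.range_ιRes_normal_Huu (l := l)
  have hk := kill_le_comap (qRes (qSub D C.Huu) (qSub D C.Huu).range C.qSub_mem_range)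
    (ιRes (ιTheta D l) (qSub D C.Huu).range C.ιTheta_mem_range)
    ((C.rigidData μ hC hS h15 L).qN (ContinuousMulEquiv.refl _)) (C.rigidData μ hC hS h15 L).iotaN
    (C.levelQuotOfRange μ hC hS h15 L) μ.red
    (C.levelQuotOfRange_comp_qRes μ hC hS h15 L) (C.levelQuotOfRange_comp_ιRes μ hC hS h15 L) (stabilizerSubgroup E x)
  rw [kill_codRestrict_eq] at hk
  have h3 := hk key
  rw [Subgroup.mem_comap, map_mul, map_inv] at h3
  exact h3

/-- **The two `Aut`-subquotient DOMAINS coincide**: `autPre(q, ι) E = autPre(q_N, ι_N) E` — an automorphism acts at a point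
as some `n ∈ Π^tp_X̲̲` with `q(n) ∈ l·Δ_Θ`, i.e. (abc-iut-w4-d042's dictionary `qN_ιX_mem_range_iff`) with `q_N(n) ∈ ι_N(μ_N)`;
only the TARGETS of the projections differ (by reduction mod `N`, `settingToLevelN_autProj`).  So abc-iut-w4-d042's pin
`hPpre : P.pre B_N^bs = (autPre q_N ι_N B_N^bs).comap mapAut` is the SAME equation for print's pair `(q, ι)`.
[cite: MochizukiEtTh2009, §5 p.327 (PDF p.101)] -/
theorem autPre_setting_eq_levelN (E : BTemp ↥C.Huu) :
    autPre (qSub D C.Huu) (ιTheta D l) E =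
      autPre ((C.rigidData μ hC hS h15 L).qN (ContinuousMulEquiv.refl _)) (C.rigidData μ hC hS h15 L).iotaN E := by
  refine le_antisymm (C.autPre_setting_le_levelN μ hC hS h15 L E) ?_
  intro σ hσ x
  obtain ⟨n, hn, hx⟩ := hσ x
  refine ⟨n, ?_, hx⟩
  have h := ((C.rigidData μ hC hS h15 L).qN_ιX_mem_range_iff (ContinuousMulEquiv.refl _) n).1 hn
  -- `n ∈ RD.lDeltaTheta = q⁻¹(l·Δ_Θ)`, i.e. `q n ∈ ι(l·Δ_Θ)`
  have h' : qSub D C.Huu n ∈ D.lDeltaTheta l := Subgroup.mem_comap.1 h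
  rw [ThetaSetting.range_subtype_lDeltaTheta]
  exact h'

end ThetaSetting.EtaleThetaData.DoubleUnderline

end Literature.AnabelianGeometry.EtaleTheta

end
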